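import Literature.AlgebraicGeometry.Resolution.LinearSectionsJets
import Literature.AlgebraicGeometry.Resolution.LinearProjectionZEtale
import Literature.AlgebraicGeometry.Resolution.Lemma411DivisorPoints
import Literature.AlgebraicGeometry.Resolution.JetsUnramified
import Mathlib.LinearAlgebra.LinearIndependent.Lemmas
import HarnessLib

/-!
# Independent jets at a point of `Z` make `pr ∘ π|_Z` unramified there

Topic: `Literature/AlgebraicGeometry/Resolution`. The pointwise input of
`DeJong1996.isGenericallyEtale_reducedProjection` (`LinearProjectionZEtale`) produced by the
generic choice of the linear forms `t₀, …, t_d` (de Jong 1996, proof of 4.11, p. 68, via 2.11 (β):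
"`Z → π(Z) → ℙ^{d-1}` is generically étale by construction"): at a closed point `z ∈ Z` with
`𝒪_{Z_red,z} = 𝒪_{X,z}/I_z` regular of dimension `d`,

* `LinSec.bijective_algebraMap_residueField_stalk` — `k → κ(z)` is bijective (`k` algebraically
  closed, `z` closed);
* `LinSec.finrank_jetSpace` — **`dim_k 𝒪_{X,z}/(I_z + 𝔪_z²) = d + 1`**
  (`BertiniAffine.finrank_quotient_maximalIdeal_sq_of_isRegularLocalRing` for `𝒪_{X,z}/I_z`);
  hence `span_jets_ne_top_of_lt` (fewer than `d + 1` jets never span — the non-degeneracy that makes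
  the generic condition `isGeneric_jetMap_notMem` available at every step) and
  `span_jets_eq_top_of_linearIndependent` (`d + 1` independent jets span);
* `LinSec.exists_span_ratioGerm_sub_constGerm_sup_eq` — **if the jets of `t₀, …, t_d` at `z` are
  linearly independent and `t₀(z) ≠ 0`, then for suitable `λₐ ∈ k` the germs
  `π^*(xₐ/x₀) - λₐ = tₐ/t₀ - λₐ` generate `𝔪_z` modulo `I_z`** (Nakayama for jets,
  `BertiniAffine.span_ratio_sub_sup_eq_maximalIdeal`, and `π^*(xₐ/x₀) = tₐ/t₀`,
  `LinSec.stalkMap_proj_germ_sec`) — hypothesis `hJ` of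
  `DeJong1996.exists_etale_nhd_reducedProjection` for `π = (t₀ : … : t_{d+1})`.

Everything is proved; no named facts.

## References

* A. J. de Jong, *Smoothness, semi-stability and alterations*, Publ. Math. IHÉS 83 (1996), 2.11
  and proof of Lemma 4.11, p. 68. [DeJong1996]
* H. Matsumura, *Commutative Ring Theory* (1986), Thm. 2.2 (Nakayama), §14. [Matsumura1987]
-/

noncomputable section

open CategoryTheory AlgebraicGeometry TopologicalSpace Opposite IsLocalRing
open Literature.AlgebraicGeometry.Morphisms.ProjCech (grading PP)
open Literature.AlgebraicGeometry.Motives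
open Literature.AlgebraicGeometry.Motives.RatFn
open Scheme.IdealSheafData

attribute [local instance] MvPolynomial.gradedAlgebra
  Literature.AlgebraicGeometry.Motives.ProjBaseChange.algebraBase

namespace Literature.AlgebraicGeometry.Resolution

universe u

namespace LinSec

open BertiniAffine DeJong1996

variable {k : Type u} [Field k] {N : ℕ} {X : Scheme.{u}} [X.Over (Spec (.of k))]
  (ι : X ⟶ PP k N)
  (hι : ι ≫ Literature.AlgebraicGeometry.Morphisms.ProjCech.toSpec k N = X ↘ Spec (.of k))

attribute [local instance] chartAlgebra

/-! ## `κ(z) = k` at a closed point -/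

include hι in
/-- **`k → κ(𝒪_{X,z})` is bijective at a closed point `z`** (`k` algebraically closed, `X ↪ ℙ^N_k`
closed): `𝒪_{X,z} ≅ Γ(chart h)_{𝔭_z}` compatibly with constants, and `κ(Γ(chart h)_{𝔭_z}) = k`.
[folklore] -/
theorem bijective_algebraMap_residueField_stalk [IsAlgClosed k] [IsClosedImmersion ι]
    {h : Fin (N + 1)} {z : X} (hz : z ∈ chart ι h) (hzc : IsClosed ({z} : Set X)) :
    Function.Bijective (algebraMap k (ResidueField (X.presheaf.stalk z))) := by
  haveI := finiteType_chart ι h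
  haveI := ptIdeal_isMaximal ι h hz hzc
  have hA := algebraMap_residueField_bijective (k := k) (ptIdeal ι h z hz)
  let e := stalkEquivAt ι h z hz
  -- `e` commutes with the constants
  have he : ∀ c : k, e (algebraMap k (Localization.AtPrime (ptIdeal ι h z hz)) c) =
      algebraMap k (X.presheaf.stalk z) c := fun c => by
    rw [IsScalarTower.algebraMap_apply k Γ(X, chart ι h) (Localization.AtPrime (ptIdeal ι h z hz)),
      stalkEquivAt_algebraMap, germ_algebraMap_chart ι hι h z hz]
  let ρ := IsLocalRing.ResidueField.mapEquiv e
  have hcomp : (algebraMap k (ResidueField (X.presheaf.stalk z)) : k → _) =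
      ρ ∘ algebraMap k (ResidueField (Localization.AtPrime (ptIdeal ι h z hz))) := by
    funext c
    change IsLocalRing.residue _ (algebraMap k (X.presheaf.stalk z) c) =
      ρ (IsLocalRing.residue _ (algebraMap k (Localization.AtPrime (ptIdeal ι h z hz)) c))
    rw [← he]
    rfl
  rw [hcomp]
  exact ρ.bijective.comp hA

/-! ## The jet space `𝒪_{X,z}/(I_z + 𝔪_z²)` has dimension `d + 1` -/

/-- The quotient map of a local ring onto a local (i.e. non-trivial) quotient is a local
homomorphism: a non-unit `a ∈ 𝔪` with `a b ≡ 1 (J)` would put the unit `1 - a b` in `J`.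
[folklore] -/
theorem _root_.Literature.AlgebraicGeometry.Resolution.PlumbingZEtale.isLocalHom_quotient_mk
    {B : Type*} [CommRing B] [IsLocalRing B] (J : Ideal B) [Nontrivial (B ⧸ J)] :
    IsLocalHom (Ideal.Quotient.mk J) := by
  refine ⟨fun a ha => ?_⟩
  by_contra hna
  obtain ⟨u, hu⟩ := ha
  obtain ⟨b, hb⟩ := Ideal.Quotient.mk_surjective (↑u⁻¹ : B ⧸ J)
  have h1 : Ideal.Quotient.mk J (1 - a * b) = 0 := by
    rw [map_sub, map_one, map_mul, hb, ← hu, Units.mul_inv, sub_self]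
  have hmem : 1 - a * b ∈ J := Ideal.Quotient.eq_zero_iff_mem.mp h1
  have hunit : IsUnit (1 - a * b) := by
    have ham : a * b ∈ maximalIdeal B := Ideal.mul_mem_right _ _ ((mem_maximalIdeal _).mpr hna)
    exact IsLocalRing.isUnit_one_sub_self_of_mem_nonunits _ ham
  have htop : J = ⊤ := Ideal.eq_top_of_isUnit_mem _ hmem hunit
  exact (Ideal.Quotient.nontrivial_iff.mp inferInstance) htop

section JetSpace

variable {z : X} (J : Ideal (X.presheaf.stalk z))

/-- `k → κ(𝒪_{X,z}/J)` is bijective when `k → κ(𝒪_{X,z})` is (`J ⊆ 𝔪_z`, the quotient being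
local). [folklore] -/
theorem bijective_algebraMap_residueField_quotient [IsLocalRing (X.presheaf.stalk z ⧸ J)]
    (hbij : Function.Bijective (algebraMap k (ResidueField (X.presheaf.stalk z)))) :
    Function.Bijective (algebraMap k (ResidueField (X.presheaf.stalk z ⧸ J))) := by
  haveI : IsLocalHom (Ideal.Quotient.mk J) := PlumbingZEtale.isLocalHom_quotient_mk J
  refine ⟨(algebraMap k _).injective, fun y => ?_⟩
  obtain ⟨y, rfl⟩ := IsLocalRing.residue_surjective y
  obtain ⟨b, rfl⟩ := Ideal.Quotient.mk_surjective y
  obtain ⟨c, hc⟩ := hbij.2 (IsLocalRing.residue _ b)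
  refine ⟨c, ?_⟩
  change IsLocalRing.residue _ (Ideal.Quotient.mk J (algebraMap k (X.presheaf.stalk z) c)) = _
  have hc' : algebraMap k (X.presheaf.stalk z) c - b ∈ maximalIdeal (X.presheaf.stalk z) :=
    Ideal.Quotient.eq.mp hc
  refine Ideal.Quotient.eq.mpr ?_
  rw [← map_sub]
  exact map_nonunit (Ideal.Quotient.mk J) _ hc'

/-- **`dim_k 𝒪_{X,z}/(J + 𝔪_z²) = d + 1`** (and the quotient is finite over `k`) when
`𝒪_{X,z}/J` is a regular local ring of dimension `d` with residue field `k`: it is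
`(𝒪_{X,z}/J)/𝔪²`, counted by `BertiniAffine.finrank_quotient_maximalIdeal_sq_of_isRegularLocalRing`.
[cite: Matsumura1987, §14] -/
theorem finrank_jetSpace [hR : IsRegularLocalRing (X.presheaf.stalk z ⧸ J)] {d : ℕ}
    (hdimR : ringKrullDim (X.presheaf.stalk z ⧸ J) = d)
    (hbij : Function.Bijective (algebraMap k (ResidueField (X.presheaf.stalk z)))) :
    Module.Finite k (X.presheaf.stalk z ⧸ (J ⊔ maximalIdeal (X.presheaf.stalk z) ^ 2)) ∧
      Module.finrank k (X.presheaf.stalk z ⧸ (J ⊔ maximalIdeal (X.presheaf.stalk z) ^ 2)) = d + 1 := by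
  obtain ⟨hfin, hfr⟩ := finrank_quotient_maximalIdeal_sq_of_isRegularLocalRing (k := k)
    (R := X.presheaf.stalk z ⧸ J) (bijective_algebraMap_residueField_quotient J hbij) hdimR
  -- `((X.presheaf.stalk z)/J)/𝔪² ≅ (X.presheaf.stalk z)/(J + 𝔪_B²)` over `k`
  haveI : IsLocalHom (Ideal.Quotient.mk J) := PlumbingZEtale.isLocalHom_quotient_mk J
  have hmax : maximalIdeal ((X.presheaf.stalk z) ⧸ J) = (maximalIdeal (X.presheaf.stalk z)).map (Ideal.Quotient.mk J) :=
    (PlumbingZEtale.map_maximalIdeal_of_surjective (Ideal.Quotient.mk J) Ideal.Quotient.mk_surjective).symm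
  have hsq : maximalIdeal ((X.presheaf.stalk z) ⧸ J) ^ 2 = (maximalIdeal (X.presheaf.stalk z) ^ 2).map (Ideal.Quotient.mk J) := by
    rw [hmax, Ideal.map_pow]
  let e : (((X.presheaf.stalk z) ⧸ J) ⧸ maximalIdeal ((X.presheaf.stalk z) ⧸ J) ^ 2) ≃ₐ[k] (X.presheaf.stalk z) ⧸ (J ⊔ maximalIdeal (X.presheaf.stalk z) ^ 2) :=
    (Ideal.quotientEquivAlgOfEq k hsq).trans (DoubleQuot.quotQuotEquivQuotSupₐ k J (maximalIdeal (X.presheaf.stalk z) ^ 2))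
  haveI := hfin
  exact ⟨Module.Finite.equiv e.toLinearEquiv, by rw [← e.toLinearEquiv.finrank_eq, hfr]⟩

/-- Fewer than `d + 1` jets never span the jet space. [folklore] -/
theorem span_jets_ne_top_of_lt [hR : IsRegularLocalRing (X.presheaf.stalk z ⧸ J)] {d : ℕ}
    (hdimR : ringKrullDim (X.presheaf.stalk z ⧸ J) = d)
    (hbij : Function.Bijective (algebraMap k (ResidueField (X.presheaf.stalk z))))
    {j : ℕ} (hj : j < d + 1)
    (v : Fin j → X.presheaf.stalk z ⧸ (J ⊔ maximalIdeal (X.presheaf.stalk z) ^ 2)) :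
    Submodule.span k (Set.range v) ≠ ⊤ := by
  obtain ⟨hfin, hfr⟩ := finrank_jetSpace J hdimR hbij
  haveI := hfin
  intro htop
  have h1 : Module.finrank k (Submodule.span k (Set.range v)) ≤ Fintype.card (Fin j) :=
    finrank_range_le_card (R := k) v
  rw [htop, finrank_top, hfr, Fintype.card_fin] at h1
  omega

/-- `d + 1` linearly independent jets span the jet space. [folklore] -/
theorem span_jets_eq_top_of_linearIndependent [hR : IsRegularLocalRing (X.presheaf.stalk z ⧸ J)]
    {d : ℕ} (hdimR : ringKrullDim (X.presheaf.stalk z ⧸ J) = d)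
    (hbij : Function.Bijective (algebraMap k (ResidueField (X.presheaf.stalk z))))
    {v : Fin (d + 1) → X.presheaf.stalk z ⧸ (J ⊔ maximalIdeal (X.presheaf.stalk z) ^ 2)}
    (hv : LinearIndependent k v) : Submodule.span k (Set.range v) = ⊤ := by
  obtain ⟨hfin, hfr⟩ := finrank_jetSpace J hdimR hbij
  haveI := hfin
  exact hv.span_eq_top_of_card_eq_finrank' (by rw [hfr, Fintype.card_fin])

end JetSpace

/-! ## Independent jets ⇒ `tₐ/t₀ - λₐ` generate `𝔪_z` modulo `I_z` -/

section Ratios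

variable [IsIntegral X] {d : ℕ} (t : Fin (d + 1 + 1) → Fin (N + 1) → k) (hbpf : NoCommonZero ι t)

include hι in
/-- **Independent jets make `π|_Z` unramified at `z`.** Let `z` be a closed point of `X` in
the chart `X_{x_h}` with `t₀(z) ≠ 0`, `J ⊆ 𝒪_{X,z}` an ideal (the stalk of the ideal of `Z`)
with `𝒪_{X,z}/J` regular of dimension `d`, and suppose the jets of `t₀, …, t_d` in
`𝒪_{X,z}/(J + 𝔪_z²)` are linearly independent. Then for the projection
`π = (t₀ : … : t_{d+1})` and suitable `λₐ ∈ k`, the germs `π^*(xₐ/x₀) - λₐ` (`a ≤ d`) generate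
`𝔪_z` modulo `J` — hypothesis `hJ` of `DeJong1996.exists_etale_nhd_reducedProjection`.
[cite: DeJong1996, 2.11 and Lemma 4.11 (proof), p. 68] [cite: Matsumura1987, Thm. 2.2] -/
theorem exists_span_ratioGerm_sub_constGerm_sup_eq [IsAlgClosed k] [IsClosedImmersion ι]
    [IsLocallyNoetherian X] {h : Fin (N + 1)} {z : X} (hz : z ∈ chart ι h) (hzc : IsClosed ({z} : Set X))
    (J : Ideal (X.presheaf.stalk z)) (hJm : J ≤ maximalIdeal (X.presheaf.stalk z))
    [hR : IsRegularLocalRing (X.presheaf.stalk z ⧸ J)]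
    (hdimR : ringKrullDim (X.presheaf.stalk z ⧸ J) = d)
    (hind : LinearIndependent k fun a : Fin (d + 1) => jetMap ι hι h z hz J (t (Fin.castSucc a)))
    (h0 : z ∉ hyp ι (t 0)) :
    ∃ (hxP : proj ι t (X ↘ Spec (.of k)) hbpf z ∈
        (ProjSpace.U (Fin.castSucc 0) : (ProjSpace.P (d + 1) k).Opens)) (lam : Fin (d + 1) → k),
      Ideal.span (Set.range fun a => ratioGerm d (proj ι t (X ↘ Spec (.of k)) hbpf) hxP a -
          constGerm (X ↘ Spec (.of k)) z (lam a)) ⊔ J = maximalIdeal (X.presheaf.stalk z) := by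
  have hxP : proj ι t (X ↘ Spec (.of k)) hbpf z ∈ (ProjSpace.U (Fin.castSucc 0) : (ProjSpace.P (d + 1) k).Opens) :=
    (proj_apply_mem_basicOpen_iff ι t _ hbpf z (Fin.castSucc 0)).mpr h0
  refine ⟨hxP, ?_⟩
  -- the germs `sₐ` of the `tₐ/x_h`, `s₀` a unit
  set s : Fin (d + 1) → (X.presheaf.stalk z) := fun a => (X.presheaf.germ (chart ι h) z hz).hom (linSec ι h (t (Fin.castSucc a)))
    with hs
  have hu : IsUnit (s 0) := by
    have := (mem_hyp_iff_not_isUnit_germ ι hz (t 0)).not.mp h0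
    rw [not_not] at this
    exact this
  -- their jets span
  have hbij := bijective_algebraMap_residueField_stalk ι hι hz hzc
  have hspan : Submodule.span k (Set.range fun a =>
      Ideal.Quotient.mk (J ⊔ maximalIdeal (X.presheaf.stalk z) ^ 2) (s a)) = ⊤ :=
    span_jets_eq_top_of_linearIndependent J hdimR hbij hind
  -- the residue values `λₐ` of the ratios `sₐ/s₀`
  have hlam : ∀ a, ∃ c : k, s a * ↑hu.unit⁻¹ - algebraMap k (X.presheaf.stalk z) c ∈ maximalIdeal (X.presheaf.stalk z) := fun a => by
    obtain ⟨c, hc⟩ := hbij.2 (IsLocalRing.residue (X.presheaf.stalk z) (s a * ↑hu.unit⁻¹))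
    refine ⟨c, ?_⟩
    rw [← Ideal.Quotient.eq]
    exact hc.symm
  choose lam hlam using hlam
  refine ⟨lam, ?_⟩
  have key := span_ratio_sub_sup_eq_maximalIdeal J hJm s hu hspan lam hlam
  -- `(proj ι t (X ↘ Spec (.of k)) hbpf)^*(xₐ/x₀) = sₐ/s₀` and the constants agree
  have hratio : ∀ a, ratioGerm d (proj ι t (X ↘ Spec (.of k)) hbpf) hxP a = s a * ↑hu.unit⁻¹ := fun a => by
    have hxU : z ∈ lsChart (formVec ι t) (Fin.castSucc 0) := mem_lsChart_of_notMem_hyp ι h0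
    have h1 : ratioGerm d (proj ι t (X ↘ Spec (.of k)) hbpf) hxP a = (X.presheaf.germ _ z hxU).hom
        (lsRatio (formVec ι t) (Fin.castSucc 0) (Fin.castSucc a)) :=
      stalkMap_proj_germ_sec ι t _ hbpf (Fin.castSucc 0) hxP hxU (Fin.castSucc a)
    have h2 := germ_lsRatio_mul_germ_linSec ι t hz hxU (Fin.castSucc a)
    rw [h1]
    refine (Units.eq_mul_inv_iff_mul_eq (c := hu.unit)).mpr ?_
    rw [IsUnit.unit_spec]
    exact h2
  have hconst : ∀ c : k, constGerm (X ↘ Spec (.of k)) z c = algebraMap k (X.presheaf.stalk z) c := fun c => rfl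
  have hfun : (fun a => ratioGerm d (proj ι t (X ↘ Spec (.of k)) hbpf) hxP a - constGerm (X ↘ Spec (.of k)) z (lam a)) =
      fun a => s a * ↑hu.unit⁻¹ - algebraMap k (X.presheaf.stalk z) (lam a) := by
    funext a; rw [hratio, hconst]
  rw [hfun]
  exact key

end Ratios

end LinSec

end Literature.AlgebraicGeometry.Resolution

end
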